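import Literature.Geometry.Lorentzian.NonRotatingBlackHoleUniqueness
import Literature.Geometry.Lorentzian.StaticBlackHoleUniquenessProofs
import Literature.Geometry.Lorentzian.StaticKillingLapseEquation
import HarnessLib

/-!
# Static uniqueness for a static domain of outer communications: proved glue lemmas

Companion (proofs-only) file of `Literature.Geometry.Lorentzian.NonRotatingBlackHoleUniqueness`
for the SECOND of its two named facts, `ChruscielGalloway2010_docStaticUniqueness` (D-0014) — the
first, `SudarskyWald1993_staticity`, is served by the sibling
`Literature.Geometry.Lorentzian.NonRotatingBlackHoleUniquenessProofs`. The fact records the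
uniqueness theorem for static vacuum black holes **in the form applied in print**: an
`I⁺`-regular, vacuum, four-dimensional stationary asymptotically flat black-hole space-time whose
stationary Killing field `T` is hypersurface-orthogonal **on the domain of outer communications**
`⟨⟨M_ext⟩⟩` and whose future event horizon is non-empty has `⟨⟨M_ext⟩⟩` isometric to a
Schwarzschild exterior `{r > 2M}`, `M > 0` (Chruściel–Costa, Astérisque 321 (2008) =
arXiv:0806.0016, Thm. 1.4 as applied in §7.2, p. 34: "Hence `⟨⟨M_ext⟩⟩` is static as well, and
Theorem 1.4 allows us to conclude that `⟨⟨M_ext⟩⟩` is Schwarzschildian"; analyticity removed by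
Chruściel–Galloway, Class. Quantum Grav. 27 (2010) 152001, Thm. 1.1 and Thm. 4.1 =
Chruściel–Costa–Heusler, Living Rev. Relativity 15 (2012) 7, Thm. 3.1 and §3.3.1).

## Status of the named fact (provefact seat, 2026-08-16): a theory, not mis-stated

The printed proof of Theorem 1.4 is one sentence — "We want to invoke [Chstatic]" (Chruściel,
Class. Quantum Grav. 16 (1999) 661, with the corrections listed on pp. 4–5 of Chruściel–Costa
2008) — on top of the structure theory of `I⁺`-regular domains of outer communications of the
same paper; unfolded, it is the following chain, of which only the algebraic links exist in the
tree:

1. `T` has no zeros on `⟨⟨M_ext⟩⟩` (Chruściel–Costa 2008, Cor. 3.8) — **proved** in the tree,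
   `StationaryAFBlackHole.IsIPlusRegular.killing_ne_zero_of_mem_doc`
   (`StationaryBlackHoleUniquenessProofs.lean`).
2. `T` is timelike on `⟨⟨M_ext⟩⟩` (no ergoregion in the static case): the Vishveshwara–Carter
   lemma (pointwise part **proved**, `IsHypersurfaceOrthogonalOn.killing_wedge_eq_of_null`,
   `….exists_leviCivita_self_eq_smul_of_null`, `StaticBlackHoleUniquenessProofs.lean`) and the
   absence of Killing prehorizons in `I⁺`-regular d.o.c.s, Chruściel–Galloway 2010, Thm. 1.1 (the
   theorem replacing analyticity; smoothness of horizons, Chruściel–Costa 2008, Thm. 4.11, and the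
   null splitting theorem) — not in the tree.
3. The orbit space `Σ = ⟨⟨M_ext⟩⟩/ℝ` with its quotient metric and a global time function,
   `⟨⟨M_ext⟩⟩ ≅ ℝ × Σ` (in the tree for chronological space-times with an everywhere timelike
   complete Killing field: `StationaryOrbitSpaceManifold.lean`, `StationaryOrbitRiemannian.lean`,
   `StationaryOrbitTrivialization.lean`, after Anderson 2000, §0), and, by staticity and simple
   connectedness of `⟨⟨M_ext⟩⟩` (topological censorship, Chruściel–Wald 1994 / Chruściel–Costa
   2008, Cor. 2.5 — not in the tree), a `T`-orthogonal slicing `g = -V² dt² + γ`.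
4. The Riemannian static vacuum data `(Σ, γ, V)`: `K = 0`, `R(γ) = 0`, `Δ_γ V = 0`,
   `Ric(γ) = V⁻¹ ∇² V` — **proved in this file for every `T`-orthogonal spacelike hypersurface of
   the d.o.c.** (from `StaticBlackHoleUniquenessProofs.lean` and `StaticKillingLapseEquation.lean`).
5. Boundary behaviour of `V` at the components of `𝓔⁺` and non-existence of degenerate
   components (Chruściel 1999, §3; Chruściel–Reall–Tod, Class. Quantum Grav. 23 (2006) 549), and
   the asymptotics `V = 1 - M/r + O(r⁻²)`, `γ - δ = O(r⁻¹)` (Chruściel–Costa 2008, §2.1–2.2) —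
   not in the tree.
6. Bunting–Masood-ul-Alam (Gen. Rel. Grav. 19 (1987) 147): the rescalings `γ± = ((1 ± V)/2)⁴ γ`
   are scalar-flat — **proved** (`PseudoRiemannianMetric.scalarCurvature_bmaConformal_eq_zero`,
   `StaticBlackHoleUniquenessProofs.lean`; specialised below with the lapse equation discharged) —
   and glue along `{V = 0}` into a complete, one-ended, scalar-flat asymptotically flat manifold
   of vanishing mass (gluing of manifolds with boundary: not in the tree), which is flat by the
   rigidity case of the positive energy theorem — the tree's **unproved** named fact
   `positive_mass_rigidity` (`MassInequalities.lean`; its own architecture is recorded in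
   `PositiveMassRigidity.lean`) — whence `γ` is conformally flat and `(Σ, γ, V)` is a
   Schwarzschild slice of mass `M > 0`.
7. An explicit isometry of `(ℝ × Σ, -V² dt² + γ)` onto the ingoing Kerr–Schild exterior
   `Kerr.exterior M 0` with `Kerr.smoothMetric M 0` (the tree's rendering of the conclusion,
   `IsIsometricToSchwarzschildExterior`) — not in the tree.

No hypothesis of the fact was found mis-stated against the sources (see the docstring of the
fact for the clause-by-clause comparison); it stays a named fact, and this file collects the
provable links, without introducing any further named fact.

## What is proved here

* `ChruscielGalloway2010_docStaticUniqueness.apply`, `….static_black_hole_uniqueness`,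
  `….alexakisIonescuKlainermanRigidity` — the logical position of the fact: it is the STRONGER of
  the two tree forms of the static classification at `I⁺`-regularity (it implies the schema
  `static_black_hole_uniqueness IsIPlusRegular`, whose staticity hypothesis `IsStatic` is asked on
  all of `M`), and it is the Alexakis–Ionescu–Klainerman schema of `BlackHoles.lean` at the
  predicate "`I⁺`-regular, static d.o.c., non-empty horizon" (the shape consumed, together with
  the Sudarsky–Wald staticity theorem, by the non-rotating branch of Chruściel–Costa–Heusler 2012,
  §3.3.1).
* **Step 4 of the chain, for hypersurfaces of the d.o.c.** Let `𝓑` be a stationary AF black hole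
  whose Killing field `T` is hypersurface-orthogonal on `⟨⟨M_ext⟩⟩`, and `f : N → M` a spacelike
  immersed hypersurface of `⟨⟨M_ext⟩⟩` with smooth unit normal `n` along which `T ∘ f = V n` for a
  smooth nowhere-vanishing lapse `V` (a leaf of `T^⊥` inside the d.o.c., where `T` is timelike):
  - `StationaryAFBlackHole.val_killing_killing_eq_of_docSlice` — `g(T, T) ∘ f = -V²` (so `T` is
    timelike along such a leaf);
  - `StationaryAFBlackHole.secondFundamentalForm_eq_zero_of_docStatic` — **`K = 0`** (the leaf is
    totally geodesic: time-symmetric data), Chruściel–Costa–Heusler 2012, §2.5.2 and §3.1;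
  - `StationaryAFBlackHole.scalarCurvature_inducedMetric_eq_zero_of_docStatic` — in vacuum,
    **`R(f^*g) = 0`** (twice-traced Gauss equation);
  - `StationaryAFBlackHole.dalembertian_lapse_eq_zero_of_docStatic` — in vacuum, the **lapse
    equation `Δ_{f^*g} V = 0`** (from `IsKillingField.lapse_mul_dalembertian_eq_neg_ricci`);
  - `StationaryAFBlackHole.ricci_inducedMetric_eq_of_docStatic` — in vacuum, the **static vacuum
    equations `Ric(f^*g) = V⁻¹ ∇² V`** (from `IsKillingField.ricci_mfderiv_mfderiv_eq_of_eq_smul_normal`);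
  - `StationaryAFBlackHole.scalarCurvature_bmaConformal_eq_zero_of_docStatic` — in vacuum, every
    smooth metric `γ' = ((1 + s V)/2)⁴ f^*g` with `1 + s V > 0` (`s = ±1`: Bunting–Masood-ul-Alam's
    `γ±`) is **scalar-flat**, with no harmonicity hypothesis left (it is the lapse equation just
    proved).
  These are Chruściel–Costa–Heusler 2012, §3.1 ("the static vacuum equations … `(Σ, γ, V)`") for
  the d.o.c.-static hypothesis of the fact, the input of steps 5–6.
* **Step 2 of the chain, interface.** `StationaryAFBlackHole.isTimelike_killing_of_forall_not_isNull`,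
  `….IsIPlusRegular.isTimelike_killing_of_forall_not_isNull` — if `T` has no null point on
  `⟨⟨M_ext⟩⟩` (and no zero, automatic under `I⁺`-regularity) then `T` is timelike on `⟨⟨M_ext⟩⟩`
  (continuity of `g(T, T)`, connectedness of the d.o.c., `T` timelike on `M_ext`); and
  `….IsIPlusRegular.isTimelike_killing_or_exists_prehorizonPoint` — for a static `I⁺`-regular
  d.o.c., EITHER `T` is timelike on `⟨⟨M_ext⟩⟩` OR some point of `⟨⟨M_ext⟩⟩` carries a null,
  non-zero `T` with `∇_T T = κ T` (a Killing-prehorizon point, by the pointwise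
  Vishveshwara–Carter identity) — the alternative excluded by Chruściel–Galloway 2010, Thm. 1.1.

## References

* P. T. Chruściel, J. L. Costa, *On uniqueness of stationary vacuum black holes*, Astérisque 321
  (2008) 195–265, arXiv:0806.0016, Thm. 1.4 (p. 4), §3 (Cor. 3.8), §7.2 (p. 34)
  (key `ChruscielCosta2008`).
* P. T. Chruściel, G. J. Galloway, *Uniqueness of static black holes without analyticity*, Class.
  Quantum Grav. 27 (2010) 152001, arXiv:1004.0513, Thm. 1.1, §3, Thm. 4.1
  (key `ChruscielGalloway2010`).
* P. T. Chruściel, J. L. Costa, M. Heusler, *Stationary black holes: uniqueness and beyond*,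
  Living Rev. Relativity 15 (2012) 7, arXiv:1205.6112, §2.5.2, §3.1 (Thm. 3.1), §3.3.1
  (key `ChruscielCostaHeusler2012`).
* P. T. Chruściel, *The classification of static vacuum space-times containing an asymptotically
  flat spacelike hypersurface with compact interior*, Class. Quantum Grav. 16 (1999) 661–687.
* G. L. Bunting, A. K. M. Masood-ul-Alam, *Nonexistence of multiple black holes in asymptotically
  Euclidean static vacuum space-time*, Gen. Rel. Grav. 19 (1987) 147–154, §2.
* P. T. Chruściel, H. S. Reall, P. Tod, *On non-existence of static vacuum black holes with
  degenerate components of the event horizon*, Class. Quantum Grav. 23 (2006) 549–554.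
* B. O'Neill, *Semi-Riemannian geometry*, Academic Press 1983, Ch. 4 (Gauss equation), Ch. 9,
  Ex. 9, Ch. 12 (static space-times) (key `ONeillSemiRiemannian1983`).
-/

noncomputable section

open Set TopologicalSpace Bundle Topology
open scoped ContDiff Manifold

universe u

namespace Literature.Geometry.Lorentzian

/-! ### Logical position of the named fact -/

/-- **Hypothesis form** of `ChruscielGalloway2010_docStaticUniqueness`: given the named fact, an
`I⁺`-regular vacuum stationary AF black hole whose Killing field is hypersurface-orthogonal on
`⟨⟨M_ext⟩⟩` and whose horizon is non-empty has d.o.c. isometric to a Schwarzschild exterior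
`{r > 2M}`, `M > 0`. Tautological unfolding. Chruściel–Costa 2008, Thm. 1.4 as applied in §7.2;
Chruściel–Costa–Heusler 2012, Thm. 3.1. [cite: ChruscielCosta2008, Thm. 1.4 and §7.2] -/
theorem ChruscielGalloway2010_docStaticUniqueness.apply
    (h : ChruscielGalloway2010_docStaticUniqueness) (𝓑 : StationaryAFBlackHole.{0})
    [𝓑.metric.HasLeviCivita] [Kerr.Facts]
    (hF : 𝓑.metric.isOpen_chronologicalFuture 𝓑.timeOrientation)
    (hP : 𝓑.metric.isOpen_chronologicalPast 𝓑.timeOrientation)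
    (hres : PseudoRiemannianMetric.contMDiff_restrict (I := 𝓡 4) (n := ∞) (M := 𝓑.carrier))
    (hreg : 𝓑.IsIPlusRegular)
    (hstat : 𝓑.metric.toPseudoRiemannianMetric.IsHypersurfaceOrthogonalOn 𝓑.killing 𝓑.doc)
    (hvac : 𝓑.metric.toPseudoRiemannianMetric.IsRicciFlat) (hne : 𝓑.horizon.Nonempty) :
    𝓑.IsIsometricToSchwarzschildExterior hF hP hres :=
  h 𝓑 hF hP hres hreg hstat hvac hne

/-- **The d.o.c. form implies the letter of Theorem 3.1 at `I⁺`-regularity.** Staticity on all of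
`M` (`IsStatic`) restricts to staticity on `⟨⟨M_ext⟩⟩` (`IsStatic.isHypersurfaceOrthogonalOn`), so
the named fact yields the static uniqueness schema `static_black_hole_uniqueness` of
`StaticBlackHoleUniqueness.lean` at the predicate `StationaryAFBlackHole.IsIPlusRegular` — the
instance of Chruściel–Costa–Heusler 2012, Thm. 3.1 (vacuum) for `I⁺`-regular space-times, whose
global hypotheses `I⁺`-regularity implies. (The converse is not available: a Killing field static
on the d.o.c. need not be static on the black-hole region.) Chruściel–Costa–Heusler 2012, Thm. 3.1
and §3.3.1. [cite: ChruscielCostaHeusler2012, Thm. 3.1] -/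
theorem ChruscielGalloway2010_docStaticUniqueness.static_black_hole_uniqueness
    (h : ChruscielGalloway2010_docStaticUniqueness) :
    static_black_hole_uniqueness StationaryAFBlackHole.IsIPlusRegular.{0} :=
  fun 𝓑 _ _ hF hP hres hreg hstat hvac hne ↦
    h 𝓑 hF hP hres hreg (hstat.isHypersurfaceOrthogonalOn 𝓑.doc) hvac hne

/-- **The named fact as an instance of the Alexakis–Ionescu–Klainerman schema**: it is the
rigidity schema `AlexakisIonescuKlainermanRigidity` of `BlackHoles.lean` at the predicate
"`I⁺`-regular, stationary Killing field hypersurface-orthogonal on `⟨⟨M_ext⟩⟩`, non-empty horizon"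
(a Schwarzschild exterior of mass `M > 0` is the subextremal Kerr exterior `(M, 0)`,
`IsIsometricToSchwarzschildExterior.isIsometricToKerrExterior`). This is the shape in which the
non-rotating branch of the uniqueness argument consumes the theorem (Chruściel–Costa–Heusler 2012,
§3.3.1: Sudarsky–Wald staticity of the d.o.c., then Theorem 3.1). The staticity clause needs the
Levi-Civita connection, whence the inner quantification over the (proof-irrelevant) instance.
[cite: ChruscielCostaHeusler2012, §3.3.1] -/
theorem ChruscielGalloway2010_docStaticUniqueness.alexakisIonescuKlainermanRigidity
    (h : ChruscielGalloway2010_docStaticUniqueness) :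
    AlexakisIonescuKlainermanRigidity.{0} fun 𝓑 ↦ 𝓑.IsIPlusRegular ∧
      (∀ [𝓑.metric.HasLeviCivita],
        𝓑.metric.toPseudoRiemannianMetric.IsHypersurfaceOrthogonalOn 𝓑.killing 𝓑.doc) ∧
      𝓑.horizon.Nonempty := by
  intro 𝓑 _ _ hF hP hres hyp hvac
  exact (h 𝓑 hF hP hres hyp.1 hyp.2.1 hvac hyp.2.2).isIsometricToKerrExterior

/-! ### Step 4: the Riemannian static vacuum data on a `T`-orthogonal hypersurface of the d.o.c.

Throughout: `𝓑` a stationary AF black hole with stationary Killing field `T = 𝓑.killing`,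
`g = 𝓑.metric`; `f : N → M` a spacelike immersion of a boundaryless `3`-manifold with unit normal
`ν` (`g(ν, ν) = -1`, smooth as a map into `TM`) taking values in the d.o.c. `𝓑.doc`, and a lapse
`V : N → ℝ` with `T (f y) = V y • ν y`. The induced metric `f^* g` is
`g.inducedMetric f hpb hfi` (`Hypersurface.lean`; `hpb` is the proved prelude fact
`PseudoRiemannianMetric.contMDiff_pullbackBilin_holds`), a Riemannian metric on `TN` whose
Levi-Civita connection gives `Δ`, `Hess`, `Ric`, `R` below. -/

namespace StationaryAFBlackHole

variable {𝓑 : StationaryAFBlackHole.{u}}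
  {N : Type*} [TopologicalSpace N] [ChartedSpace E3 N] [IsManifold (𝓡 3) ∞ N]
  {f : N → 𝓑.carrier} {ν : NormalField (𝓡 4) f} {V : N → ℝ}

/-- The dimension count `dim ℝ⁴ = dim ℝ³ + 1` of a hypersurface of space-time. [folklore] -/
private lemma finrank_E4_eq : Module.finrank ℝ E4 = Module.finrank ℝ E3 + 1 := by
  rw [finrank_euclideanSpace_fin, finrank_euclideanSpace_fin]

omit [IsManifold (𝓡 3) ∞ N] in
/-- A unit normal of sign `-1` is nowhere zero. [folklore] -/
private lemma normal_ne_zero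
    (hun : 𝓑.metric.toPseudoRiemannianMetric.IsUnitNormal (𝓡 3) f ν (-1)) (y : N) : ν y ≠ 0 := by
  intro h0
  have h1 := hun.val_self y
  rw [h0, map_zero] at h1
  norm_num at h1

omit [IsManifold (𝓡 3) ∞ N] in
/-- **`g(T, T) = -V²` along a leaf with `T = V n`.** If the stationary Killing field is `V • ν`
along `f` for a unit normal `ν` of sign `-1`, then `g(T, T)(f y) = -(V y)²`; in particular `T` is
timelike along the leaf wherever `V ≠ 0` (the lapse of the static form `g = -V² dt² + γ`,
`V² = -g(T, T)`). O'Neill 1983, Ch. 12 (static space-times, `V² = -⟨∂ₜ, ∂ₜ⟩`);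
Chruściel–Costa–Heusler 2012, §3.1. [cite: ChruscielCostaHeusler2012, §3.1] -/
theorem val_killing_killing_eq_of_docSlice
    (hun : 𝓑.metric.toPseudoRiemannianMetric.IsUnitNormal (𝓡 3) f ν (-1))
    (hprop : ∀ y, 𝓑.killing (f y) = V y • ν y) (y : N) :
    𝓑.metric.val (f y) (𝓑.killing (f y)) (𝓑.killing (f y)) = -(V y) ^ 2 := by
  have h1 : 𝓑.metric.toPseudoRiemannianMetric.val (f y) (ν y) (ν y) = -1 := hun.val_self y
  change 𝓑.metric.toPseudoRiemannianMetric.val (f y) (𝓑.killing (f y)) (𝓑.killing (f y)) = _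
  rw [hprop y, map_smul, map_smul, _root_.smul_apply, smul_eq_mul, smul_eq_mul, h1]
  ring

/-- **Leaves of `T^⊥` in a static d.o.c. are totally geodesic (`K = 0`, time-symmetric data).**
Let the stationary Killing field `T` be hypersurface-orthogonal on `⟨⟨M_ext⟩⟩` and let
`f : N → ⟨⟨M_ext⟩⟩ ⊆ M` be a hypersurface (differentiable, boundaryless `N`) with unit normal `ν`
of sign `-1` and `T ∘ f = V • ν`, `V` nowhere zero and differentiable. Then the second fundamental
form of `f` with respect to `ν` vanishes identically
(`IsHypersurfaceOrthogonalOn.isTotallyGeodesic_of_killing_eq_smul` at `A = ⟨⟨M_ext⟩⟩`): the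
static slices carry time-symmetric data `K_{ij} = 0`. Chruściel–Costa–Heusler 2012, §2.5.2 (leaves
of `k^⊥` are totally geodesic off the zero set) and §3.1; Wald 1984, §6.1. [cite: ChruscielCostaHeusler2012, §2.5.2 and §3.1] -/
theorem secondFundamentalForm_eq_zero_of_docStatic [𝓑.metric.HasLeviCivita]
    (hstat : 𝓑.metric.toPseudoRiemannianMetric.IsHypersurfaceOrthogonalOn 𝓑.killing 𝓑.doc)
    (hf : ∀ y, MDifferentiableAt (𝓡 3) (𝓡 4) f y) (hfdoc : ∀ y, f y ∈ 𝓑.doc)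
    (hun : 𝓑.metric.toPseudoRiemannianMetric.IsUnitNormal (𝓡 3) f ν (-1))
    (hV : ∀ y, V y ≠ 0) (hVd : ∀ y, MDifferentiableAt (𝓡 3) 𝓘(ℝ, ℝ) V y)
    (hprop : ∀ y, 𝓑.killing (f y) = V y • ν y) (y : N) :
    𝓑.metric.toPseudoRiemannianMetric.secondFundamentalForm (𝓡 3) f ν y = 0 :=
  PseudoRiemannianMetric.IsHypersurfaceOrthogonalOn.isTotallyGeodesic_of_killing_eq_smul hstat
    𝓑.isStationaryKilling.isKillingField hf (fun _ ↦ BoundarylessManifold.isInteriorPoint) hfdoc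
    hV hVd (normal_ne_zero hun) (fun y w ↦ hun.isNormalTo y w) hprop y

/-- **A `T`-orthogonal hypersurface of a static vacuum d.o.c. is scalar-flat: `R(f^*g) = 0`.**
Under the hypotheses of `secondFundamentalForm_eq_zero_of_docStatic`, with `f` a smooth spacelike
immersion, `ν` smooth as a map into `TM`, and `𝓑` vacuum (`Ric(g) = 0`): by the twice-traced Gauss
equation (`scalarCurvature_inducedMetric_eq_general`, O'Neill 1983, Ch. 4, Thm. 5 and Corollary,
`ε = -1`) `R(f^*g) = R(g) + 2 Ric(ν, ν) - (H² - |K|²) = 0`. This is the Hamiltonian constraint of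
the time-symmetric vacuum data `(Σ, γ)` of the static problem. Chruściel–Costa–Heusler 2012, §3.1;
Wald 1984, (10.2.30) with `K_{ab} = 0`. [cite: ChruscielCostaHeusler2012, §3.1 (static vacuum data are time-symmetric and scalar-flat)] -/
theorem scalarCurvature_inducedMetric_eq_zero_of_docStatic [𝓑.metric.HasLeviCivita]
    (hstat : 𝓑.metric.toPseudoRiemannianMetric.IsHypersurfaceOrthogonalOn 𝓑.killing 𝓑.doc)
    (hvac : 𝓑.metric.toPseudoRiemannianMetric.IsRicciFlat)
    (hfi : 𝓑.metric.toPseudoRiemannianMetric.IsSpacelikeImmersion (𝓡 3) f)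
    (hfdoc : ∀ y, f y ∈ 𝓑.doc)
    (hun : 𝓑.metric.toPseudoRiemannianMetric.IsUnitNormal (𝓡 3) f ν (-1))
    (hν : ContMDiff (𝓡 3) (𝓡 4).tangent ∞
      (fun x ↦ (TotalSpace.mk' E4 (f x) (ν x) : TangentBundle (𝓡 4) 𝓑.carrier)))
    (hV : ∀ y, V y ≠ 0) (hVd : ∀ y, MDifferentiableAt (𝓡 3) 𝓘(ℝ, ℝ) V y)
    (hprop : ∀ y, 𝓑.killing (f y) = V y • ν y) (y : N) :
    haveI := (𝓑.metric.toPseudoRiemannianMetric.inducedMetric f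
      PseudoRiemannianMetric.contMDiff_pullbackBilin_holds hfi).hasLeviCivita
    (𝓑.metric.toPseudoRiemannianMetric.inducedMetric f
      PseudoRiemannianMetric.contMDiff_pullbackBilin_holds hfi).scalarCurvature y = 0 := by
  set g := 𝓑.metric.toPseudoRiemannianMetric with hg
  haveI := (g.inducedMetric f PseudoRiemannianMetric.contMDiff_pullbackBilin_holds
    hfi).hasLeviCivita
  have hm : Module.finrank ℝ E3 = 3 := finrank_euclideanSpace_fin
  have hm1 : Module.finrank ℝ E4 = 3 + 1 := finrank_euclideanSpace_fin
  have hG := PseudoRiemannianMetric.scalarCurvature_inducedMetric_eq_general g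
    PseudoRiemannianMetric.contMDiff_pullbackBilin_holds hfi hν hun (by norm_num) hm hm1 y
  -- vacuum: `Ric = 0`, `R(g) = 0`; static: `K = 0`, hence `H = 0`, `|K|² = 0`
  have hK : g.secondFundamentalForm (𝓡 3) f ν y = 0 :=
    secondFundamentalForm_eq_zero_of_docStatic hstat
      (fun z ↦ (hfi.contMDiff_self z).mdifferentiableAt (by simp)) hfdoc hun hV hVd hprop y
  have hRic : g.ricci (f y) = 0 := hvac _
  have hS : g.scalarCurvature (f y) = 0 := by
    simp [PseudoRiemannianMetric.scalarCurvature, hRic, PseudoRiemannianMetric.trace]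
  have hH : g.meanCurvature f PseudoRiemannianMetric.contMDiff_pullbackBilin_holds hfi ν y = 0 := by
    simp [PseudoRiemannianMetric.meanCurvature, hK, PseudoRiemannianMetric.trace]
  rw [hK, hH, hRic, hS, PseudoRiemannianMetric.normSq_zero] at hG
  simp only [LinearMap.zero_apply, mul_zero, zero_div, sub_zero, zero_pow two_ne_zero,
    add_zero] at hG
  exact hG

/-- **The lapse equation `Δ_{f^*g} V = 0` of a static vacuum d.o.c.** Under the hypotheses of
`scalarCurvature_inducedMetric_eq_zero_of_docStatic` with `V` of class `C²`: the identity
`ε V Δ_{f^*g} V = -Ric_g(T, T)` for a Killing field normal to a totally geodesic slice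
(`IsKillingField.lapse_mul_dalembertian_eq_neg_ricci`, `StaticKillingLapseEquation.lean`; O'Neill
1983, Ch. 9, Ex. 9 evaluated on the slice), with `ε = -1`, `K = 0`
(`secondFundamentalForm_eq_zero_of_docStatic`), `V ≠ 0` and `Ric(g) = 0`, gives `Δ_{f^*g} V = 0`:
the lapse `V = √(-g(T, T))` is harmonic for the induced metric. Chruściel–Costa–Heusler 2012, §3.1
(static vacuum equations: `Δ_γ V = 0`); Anderson 2000, §1.2, (1.4). [cite: ChruscielCostaHeusler2012, §3.1 (static vacuum: Δ_γ V = 0)] -/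
theorem dalembertian_lapse_eq_zero_of_docStatic [𝓑.metric.HasLeviCivita]
    (hstat : 𝓑.metric.toPseudoRiemannianMetric.IsHypersurfaceOrthogonalOn 𝓑.killing 𝓑.doc)
    (hvac : 𝓑.metric.toPseudoRiemannianMetric.IsRicciFlat)
    (hfi : 𝓑.metric.toPseudoRiemannianMetric.IsSpacelikeImmersion (𝓡 3) f)
    (hfdoc : ∀ y, f y ∈ 𝓑.doc)
    (hun : 𝓑.metric.toPseudoRiemannianMetric.IsUnitNormal (𝓡 3) f ν (-1))
    (hν : ContMDiff (𝓡 3) (𝓡 4).tangent ∞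
      (fun x ↦ (TotalSpace.mk' E4 (f x) (ν x) : TangentBundle (𝓡 4) 𝓑.carrier)))
    (hV : ∀ y, V y ≠ 0) (hV2 : ContMDiff (𝓡 3) 𝓘(ℝ, ℝ) 2 V)
    (hprop : ∀ y, 𝓑.killing (f y) = V y • ν y) (y : N) :
    haveI := (𝓑.metric.toPseudoRiemannianMetric.inducedMetric f
      PseudoRiemannianMetric.contMDiff_pullbackBilin_holds hfi).hasLeviCivita
    (𝓑.metric.toPseudoRiemannianMetric.inducedMetric f
      PseudoRiemannianMetric.contMDiff_pullbackBilin_holds hfi).dalembertian V y = 0 := by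
  set g := 𝓑.metric.toPseudoRiemannianMetric with hg
  haveI := (g.inducedMetric f PseudoRiemannianMetric.contMDiff_pullbackBilin_holds
    hfi).hasLeviCivita
  have hVd : ∀ y, MDifferentiableAt (𝓡 3) 𝓘(ℝ, ℝ) V y := fun z ↦
    (hV2 z).mdifferentiableAt two_ne_zero
  have hK : g.secondFundamentalForm (𝓡 3) f ν y = 0 :=
    secondFundamentalForm_eq_zero_of_docStatic hstat
      (fun z ↦ (hfi.contMDiff_self z).mdifferentiableAt (by simp)) hfdoc hun hV hVd hprop y
  have h := 𝓑.isStationaryKilling.isKillingField.lapse_mul_dalembertian_eq_neg_ricci g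
    PseudoRiemannianMetric.contMDiff_pullbackBilin_holds hfi hun (by norm_num) hν finrank_E4_eq
    hV2 hprop hK (hV y)
  have hRic : g.ricci (f y) = 0 := hvac _
  rw [hRic, LinearMap.zero_apply, LinearMap.zero_apply, neg_zero] at h
  have h' : V y * (g.inducedMetric f PseudoRiemannianMetric.contMDiff_pullbackBilin_holds
      hfi).dalembertian V y = 0 := by
    linarith
  exact (mul_eq_zero.mp h').resolve_left (hV y)

/-- **The static vacuum equations `Ric(f^*g) = V⁻¹ ∇² V` on a `T`-orthogonal hypersurface of a
static vacuum d.o.c.** Under the hypotheses of `dalembertian_lapse_eq_zero_of_docStatic`: the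
tangential static field equations `Ric_g(df u, df w) = Ric_{f^*g}(u, w) - V⁻¹ Hess_{f^*g} V(u, w)`
(`IsKillingField.ricci_mfderiv_mfderiv_eq_of_eq_smul_normal`, the contracted Gauss equation at a
totally geodesic point plus the normal curvatures of the Killing flow) with `Ric(g) = 0` give
`Ric_{f^*g}(u, w) = V⁻¹ Hess_{f^*g} V(u, w)`. Together with the lapse equation these are the
static vacuum Einstein equations of the Riemannian formulation `(Σ, γ, V)` with which the
uniqueness theorems of Israel, Bunting–Masood-ul-Alam and Chruściel begin. Chruściel–Costa–Heusler
2012, §3.1; Heusler 1996, (2.13)–(2.15). [cite: ChruscielCostaHeusler2012, §3.1 (static vacuum equations Ric(γ) = V⁻¹∇²V)] -/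
theorem ricci_inducedMetric_eq_of_docStatic [𝓑.metric.HasLeviCivita]
    (hstat : 𝓑.metric.toPseudoRiemannianMetric.IsHypersurfaceOrthogonalOn 𝓑.killing 𝓑.doc)
    (hvac : 𝓑.metric.toPseudoRiemannianMetric.IsRicciFlat)
    (hfi : 𝓑.metric.toPseudoRiemannianMetric.IsSpacelikeImmersion (𝓡 3) f)
    (hfdoc : ∀ y, f y ∈ 𝓑.doc)
    (hun : 𝓑.metric.toPseudoRiemannianMetric.IsUnitNormal (𝓡 3) f ν (-1))
    (hν : ContMDiff (𝓡 3) (𝓡 4).tangent ∞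
      (fun x ↦ (TotalSpace.mk' E4 (f x) (ν x) : TangentBundle (𝓡 4) 𝓑.carrier)))
    (hV : ∀ y, V y ≠ 0) (hV2 : ContMDiff (𝓡 3) 𝓘(ℝ, ℝ) 2 V)
    (hprop : ∀ y, 𝓑.killing (f y) = V y • ν y) (y : N) (u w : TangentSpace (𝓡 3) y) :
    haveI := (𝓑.metric.toPseudoRiemannianMetric.inducedMetric f
      PseudoRiemannianMetric.contMDiff_pullbackBilin_holds hfi).hasLeviCivita
    (𝓑.metric.toPseudoRiemannianMetric.inducedMetric f
      PseudoRiemannianMetric.contMDiff_pullbackBilin_holds hfi).ricci y u w =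
      (V y)⁻¹ * (𝓑.metric.toPseudoRiemannianMetric.inducedMetric f
        PseudoRiemannianMetric.contMDiff_pullbackBilin_holds hfi).hessian V y u w := by
  set g := 𝓑.metric.toPseudoRiemannianMetric with hg
  haveI := (g.inducedMetric f PseudoRiemannianMetric.contMDiff_pullbackBilin_holds
    hfi).hasLeviCivita
  have hVd : ∀ y, MDifferentiableAt (𝓡 3) 𝓘(ℝ, ℝ) V y := fun z ↦
    (hV2 z).mdifferentiableAt two_ne_zero
  have hK : g.secondFundamentalForm (𝓡 3) f ν y = 0 :=
    secondFundamentalForm_eq_zero_of_docStatic hstat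
      (fun z ↦ (hfi.contMDiff_self z).mdifferentiableAt (by simp)) hfdoc hun hV hVd hprop y
  have h := 𝓑.isStationaryKilling.isKillingField.ricci_mfderiv_mfderiv_eq_of_eq_smul_normal g
    PseudoRiemannianMetric.contMDiff_pullbackBilin_holds hfi hun (by norm_num) hν finrank_E4_eq
    hV2 hprop hK (hV y) u w
  have hRic : g.ricci (f y) = 0 := hvac _
  rw [hRic, LinearMap.zero_apply, LinearMap.zero_apply] at h
  linarith

/-- **Bunting–Masood-ul-Alam's rescalings of a static vacuum slice of the d.o.c. are
scalar-flat.** Under the hypotheses of `dalembertian_lapse_eq_zero_of_docStatic` with `V` smooth,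
for every `s ∈ ℝ` (meant: `s = ±1`) with `1 + s V > 0` on `N`, every smooth metric `γ'` on `N`
with `γ' = ((1 + s V)/2)⁴ · f^*g` pointwise has vanishing scalar curvature: `f^*g` is scalar-flat
(`scalarCurvature_inducedMetric_eq_zero_of_docStatic`) and `V` is `f^*g`-harmonic
(`dalembertian_lapse_eq_zero_of_docStatic`), so `PseudoRiemannianMetric.scalarCurvature_bmaConformal_eq_zero`
(the conformal law `R(φ⁴ γ) = φ⁻⁵ (R(γ) φ - 8 Δ_γ φ)`, Schoen–Yau 1979, p. 49) applies — here with
no harmonicity hypothesis left over. These are the metrics `γ± = ((1 ± V)/2)⁴ γ` which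
Bunting–Masood-ul-Alam glue along `{V = 0}` and to which the rigidity case of the positive energy
theorem is applied (Bunting–Masood-ul-Alam 1987, §2; Chruściel–Costa–Heusler 2012, §3.1: "A
breakthrough was made by Bunting and Masood-ul-Alam, who showed how to use the positive energy
theorem to exclude non-connected configurations"). [cite: ChruscielCostaHeusler2012, §3.1 (Bunting–Masood-ul-Alam conformal argument)] -/
theorem scalarCurvature_bmaConformal_eq_zero_of_docStatic [𝓑.metric.HasLeviCivita]
    (hstat : 𝓑.metric.toPseudoRiemannianMetric.IsHypersurfaceOrthogonalOn 𝓑.killing 𝓑.doc)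
    (hvac : 𝓑.metric.toPseudoRiemannianMetric.IsRicciFlat)
    (hfi : 𝓑.metric.toPseudoRiemannianMetric.IsSpacelikeImmersion (𝓡 3) f)
    (hfdoc : ∀ y, f y ∈ 𝓑.doc)
    (hun : 𝓑.metric.toPseudoRiemannianMetric.IsUnitNormal (𝓡 3) f ν (-1))
    (hν : ContMDiff (𝓡 3) (𝓡 4).tangent ∞
      (fun x ↦ (TotalSpace.mk' E4 (f x) (ν x) : TangentBundle (𝓡 4) 𝓑.carrier)))
    (hV : ∀ y, V y ≠ 0) (hVs : ContMDiff (𝓡 3) 𝓘(ℝ, ℝ) ∞ V)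
    (hprop : ∀ y, 𝓑.killing (f y) = V y • ν y) (s : ℝ) (hpos : ∀ y, 0 < (1 + s * V y) / 2)
    (γ' : PseudoRiemannianMetric (𝓡 3) ∞ E3 (TangentSpace (𝓡 3) : N → Type _))
    [γ'.HasLeviCivita]
    (hγ' : ∀ (y : N) (v w : TangentSpace (𝓡 3) y),
      γ'.val y v w = ((1 + s * V y) / 2) ^ 4 *
        (𝓑.metric.toPseudoRiemannianMetric.inducedMetric f
          PseudoRiemannianMetric.contMDiff_pullbackBilin_holds hfi).val y v w) (y : N) :
    γ'.scalarCurvature y = 0 := by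
  set g := 𝓑.metric.toPseudoRiemannianMetric with hg
  haveI := (g.inducedMetric f PseudoRiemannianMetric.contMDiff_pullbackBilin_holds
    hfi).hasLeviCivita
  have hV2 : ContMDiff (𝓡 3) 𝓘(ℝ, ℝ) 2 V := hVs.of_le (by exact WithTop.coe_le_coe.2 le_top)
  have hVd : ∀ y, MDifferentiableAt (𝓡 3) 𝓘(ℝ, ℝ) V y := fun z ↦
    (hV2 z).mdifferentiableAt two_ne_zero
  exact PseudoRiemannianMetric.scalarCurvature_bmaConformal_eq_zero
    (g.inducedMetric f PseudoRiemannianMetric.contMDiff_pullbackBilin_holds hfi) γ'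
    (g.isRiemannian_inducedMetric f PseudoRiemannianMetric.contMDiff_pullbackBilin_holds hfi)
    (fun x ↦ scalarCurvature_inducedMetric_eq_zero_of_docStatic hstat hvac hfi hfdoc hun hν hV hVd
      hprop x)
    hVs (fun x ↦ dalembertian_lapse_eq_zero_of_docStatic hstat hvac hfi hfdoc hun hν hV hV2 hprop x)
    s hpos hγ' y

end StationaryAFBlackHole

/-! ### Step 2, interface: `T` is timelike on the d.o.c. unless a Killing prehorizon meets it

The analytic input replaced by Chruściel–Galloway 2010, Thm. 1.1 ("`I⁺`-regular stationary
d.o.c.s satisfying the null energy condition do not contain prehorizons") enters the static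
classification only through its consequence that the static Killing field is **timelike on
`⟨⟨M_ext⟩⟩`** (Chruściel–Costa 2008, p. 5: "This implies that `X` is timelike on
`⟨⟨M_ext⟩⟩ ⊃ S`"; Chruściel–Costa–Heusler 2012, §3.1: "the Vishveshwara–Carter lemma … shows that
null orbits of static Killing vectors form a prehorizon"). The reduction of that consequence to
the absence of NULL POINTS of `T` in the d.o.c. is elementary and proved here: `T` has no zeros
on `⟨⟨M_ext⟩⟩` (Chruściel–Costa 2008, Cor. 3.8), `⟨⟨M_ext⟩⟩` is connected and meets the region
`M_ext` where `T` is timelike, and `x ↦ g(T, T)` is continuous; and at a null point of a static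
`T` the pointwise Vishveshwara–Carter identity gives `∇_T T = κ T` — a point of a Killing
prehorizon inside the d.o.c., which is what Theorem 1.1 of Chruściel–Galloway excludes. -/

namespace StationaryAFBlackHole

variable {𝓑 : StationaryAFBlackHole.{u}}

/-- **`x ↦ g(T, T)` is continuous** (indeed `C^∞`: the stationary Killing field is a smooth
section and `g` a smooth metric; `PseudoRiemannianMetric.contMDiffAt_val_apply`). O'Neill 1983,
Ch. 9, Def. 9.22. [folklore] -/
theorem continuous_val_killing_killing [𝓑.metric.HasLeviCivita] :
    Continuous fun x ↦ 𝓑.metric.val x (𝓑.killing x) (𝓑.killing x) := by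
  have hX := 𝓑.isStationaryKilling.isKillingField.contMDiff
  have h : ContMDiff (𝓡 4) 𝓘(ℝ, ℝ) ∞ (fun x ↦ 𝓑.metric.toPseudoRiemannianMetric.val x
      (𝓑.killing x) (𝓑.killing x)) := fun x ↦
    𝓑.metric.toPseudoRiemannianMetric.contMDiffAt_val_apply le_rfl (hX x) (hX x)
  exact h.continuous

/-- **No null point and no zero of `T` in the d.o.c. ⟹ `T` is timelike on the d.o.c.** If the
stationary Killing field `T` of `𝓑` vanishes nowhere on `⟨⟨M_ext⟩⟩` and is null nowhere on
`⟨⟨M_ext⟩⟩`, then it is timelike at every point of `⟨⟨M_ext⟩⟩`: the continuous function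
`g(T, T)` does not vanish on the connected set `⟨⟨M_ext⟩⟩` (`isConnected_doc`) and is negative on
`M_ext ⊆ ⟨⟨M_ext⟩⟩` (`Mext_subset_doc`, `Mext_nonempty`), hence negative throughout (intermediate
value theorem on a preconnected set). This is the elementary half of "no prehorizons, hence no
ergoregion, in a static d.o.c." (Chruściel–Costa 2008, p. 5; Chruściel–Galloway 2010, Thm. 1.1
and §3). [cite: ChruscielCosta2008, §1.1 p. 5 (X timelike on the d.o.c.)] -/
theorem isTimelike_killing_of_forall_not_isNull [𝓑.metric.HasLeviCivita]
    (hne : ∀ p ∈ 𝓑.doc, 𝓑.killing p ≠ 0)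
    (hnull : ∀ p ∈ 𝓑.doc, ¬ 𝓑.metric.IsNull (𝓑.killing p)) {p : 𝓑.carrier} (hp : p ∈ 𝓑.doc) :
    𝓑.metric.IsTimelike (𝓑.killing p) := by
  set φ : 𝓑.carrier → ℝ := fun x ↦ 𝓑.metric.val x (𝓑.killing x) (𝓑.killing x) with hφ
  have hφc : Continuous φ := continuous_val_killing_killing
  have hφ0 : ∀ q ∈ 𝓑.doc, φ q ≠ 0 := fun q hq h0 ↦ hnull q hq ⟨h0, hne q hq⟩
  obtain ⟨m, hm⟩ := 𝓑.Mext_nonempty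
  have hmdoc : m ∈ 𝓑.doc := 𝓑.Mext_subset_doc hm
  have hmneg : φ m < 0 := (𝓑.isStationaryKilling.isTimelike hm).1
  by_contra hpt
  have hppos : 0 ≤ φ p := not_lt.mp hpt
  have hicc : Set.Icc (φ m) (φ p) ⊆ φ '' 𝓑.doc :=
    𝓑.isConnected_doc.isPreconnected.intermediate_value hmdoc hp hφc.continuousOn
  obtain ⟨q, hq, hq0⟩ := hicc ⟨hmneg.le, hppos⟩
  exact hφ0 q hq hq0

/-- **In an `I⁺`-regular black hole, `T` is timelike on the d.o.c. as soon as it has no null point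
there** (the zeros being excluded by Chruściel–Costa 2008, Cor. 3.8,
`IsIPlusRegular.killing_ne_zero_of_mem_doc`). Chruściel–Costa 2008, §1.1, p. 5 and Cor. 3.8. [cite: ChruscielCosta2008, Cor. 3.8 and §1.1 p. 5] -/
theorem IsIPlusRegular.isTimelike_killing_of_forall_not_isNull [𝓑.metric.HasLeviCivita]
    (hreg : 𝓑.IsIPlusRegular) (hnull : ∀ p ∈ 𝓑.doc, ¬ 𝓑.metric.IsNull (𝓑.killing p))
    {p : 𝓑.carrier} (hp : p ∈ 𝓑.doc) : 𝓑.metric.IsTimelike (𝓑.killing p) :=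
  StationaryAFBlackHole.isTimelike_killing_of_forall_not_isNull
    (fun _ hq ↦ hreg.killing_ne_zero_of_mem_doc hq) hnull hp

/-- **Dichotomy for a static `I⁺`-regular d.o.c.: either `T` is timelike on all of `⟨⟨M_ext⟩⟩`,
or `⟨⟨M_ext⟩⟩` contains a point of a Killing prehorizon of `T`** — a point `q` at which `T` is
null and non-zero with `∇_T T = κ T` (pointwise Vishveshwara–Carter identity for the static
Killing field, `IsHypersurfaceOrthogonalOn.exists_leviCivita_self_eq_smul_of_null`). The second
alternative is what Chruściel–Galloway 2010, Thm. 1.1 rules out (for `I⁺`-regular d.o.c.s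
satisfying the null energy condition, in particular in vacuum); granted that theorem, the static
Killing field of the named fact is timelike on `⟨⟨M_ext⟩⟩`, which with chronology of the d.o.c.
is the setting of the orbit-space construction (`StationaryOrbitSpaceManifold.lean` ff.).
Chruściel–Costa–Heusler 2012, §2.5.2–2.5.3 and §3.1; Chruściel–Galloway 2010, Thm. 1.1. [cite: ChruscielGalloway2010, Thm. 1.1 (what it excludes); ChruscielCostaHeusler2012 §3.1] -/
theorem IsIPlusRegular.isTimelike_killing_or_exists_prehorizonPoint [𝓑.metric.HasLeviCivita]
    (hreg : 𝓑.IsIPlusRegular)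
    (hstat : 𝓑.metric.toPseudoRiemannianMetric.IsHypersurfaceOrthogonalOn 𝓑.killing 𝓑.doc) :
    (∀ p ∈ 𝓑.doc, 𝓑.metric.IsTimelike (𝓑.killing p)) ∨
      ∃ q ∈ 𝓑.doc, 𝓑.metric.IsNull (𝓑.killing q) ∧
        ∃ κ : ℝ, 𝓑.metric.toPseudoRiemannianMetric.leviCivita 𝓑.killing q (𝓑.killing q) =
          κ • 𝓑.killing q := by
  by_cases hnull : ∀ p ∈ 𝓑.doc, ¬ 𝓑.metric.IsNull (𝓑.killing p)
  · exact Or.inl fun p hp ↦ hreg.isTimelike_killing_of_forall_not_isNull hnull hp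
  · push Not at hnull
    obtain ⟨q, hq, hqnull⟩ := hnull
    exact Or.inr ⟨q, hq, hqnull,
      PseudoRiemannianMetric.IsHypersurfaceOrthogonalOn.exists_leviCivita_self_eq_smul_of_null
        hstat 𝓑.isStationaryKilling.isKillingField hq hqnull.1 hqnull.2⟩

end StationaryAFBlackHole

end Literature.Geometry.Lorentzian

end
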